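import Summits.BirchSwinnertonDyer.BirchSwinnertonDyer.Theorems.EisensteinDepletionAtTwoStarOptBNSFOddTransportArch
import HarnessLib

/-!
# Line `nsf` v3 on crux `StarOptBNSF` (item stmt-BirchSwinnertonDyer-27047): the registered stubs
# `stub_oddIsoUnique` and `stub_oddIsoArch`, VERBATIM, from the archimedean transport theorems

Lead bsd-rank2-star-p1 GEN 7.  Planner p2 GEN 32 split `stub_oddIsogenyInvariance` (nsf v2) into
`stub_oddIsoUnique` (an odd-degree isogeny carries a UNIQUE rational point of order `2` to a UNIQUE rational
point of order `2`), `stub_oddIsoArch` (it preserves Greenberg's archimedean type bit «odd») and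
`stub_oddIsoTwoAdic` (the 2-adic bit; NOT proved here).  The first two are the by-name corollaries of
`…OddTransportArch` (`exists_hasUniqueRationalTwoTorsionX_of_isogeny_of_odd`,
`twoTorsionOdd_iff_of_isogeny_apply_eq`): the image of the rational 2-torsion point `T` is `Γ_ℚ`-fixed and
non-zero (odd degree), hence THE rational 2-torsion point `T′` of `W′` by uniqueness, and «odd» ⟺ «has an
anti-real half in `E(ℂ)`» is transported by `φ_ℂ`, which commutes with complex conjugation.

HONEST FRAMING: two registered stubs of an OPEN crux; `StarOptBNSF` (27047) still needs `stub_thmAShadow`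
(research), `stub_oddIsoTwoAdic`, `stub_twoPowerWalk`; `E1M_NSF` (27021) / BSD are NOT proved by this;
nothing here reads an analytic rank.

References: R. Greenberg, LNM 1716 (1999), §5 p. 168, Remark p. 174 [GreenbergLNM1716]; J. H. Silverman,
*AEC*, GTM 106 (2009), III.4.11, III.6.1–6.2, VIII.§1 [SilvermanAEC2009].
-/

set_option linter.dupNamespace false
set_option autoImplicit false

noncomputable section

open scoped Classical
open WeierstrassCurve Literature.NumberTheory.EllipticCurves
  Literature.NumberTheory.EllipticCurves.Greenberg1999

namespace Summit.BirchSwinnertonDyer.BirchSwinnertonDyer.Theorems.DepletionAtTwo.NsfStubs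

open Summit.BirchSwinnertonDyer.BirchSwinnertonDyer.Theorems.DepletionAtTwo.ArchTransport

/-- **`stub_oddIsoUnique` (line `nsf` v3, registered on stmt-BirchSwinnertonDyer-27047), verbatim.**  An
isogeny of odd degree between elliptic curves over `ℚ` carries a unique rational point of order `2` to a
unique rational point of order `2` (its image: `Γ_ℚ`-fixed, non-zero since `φ̂φ = [deg φ]` with `deg φ` odd;
unique since the dual isogeny, of the same odd degree, is injective on `2`-torsion).
[cite: SilvermanAEC2009, Cor. III.4.11, Thm. III.6.1–6.2, VIII.§1] -/
theorem stub_oddIsoUnique :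
    ∀ (W W' : WeierstrassCurve ℚ) [W.IsElliptic] [W'.IsElliptic] (φ : WeierstrassCurve.Isogeny W W'),
      Odd φ.degree → ∀ x : ℚ, HasUniqueRationalTwoTorsionX W x → ∃ x' : ℚ, HasUniqueRationalTwoTorsionX W' x' := by
  intro W W' _ _ φ hdeg x hx
  obtain ⟨⟨y, hxy, h2⟩, huniq⟩ := hx
  have hT : W.toAffine.Nonsingular x y := (WeierstrassCurve.Affine.equation_iff_nonsingular).mp hxy
  obtain ⟨x', -, -, -, hx'⟩ := exists_hasUniqueRationalTwoTorsionX_of_isogeny_of_odd φ hdeg hT h2 huniq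
  exact ⟨x', hx'⟩

/-- **`stub_oddIsoArch` (line `nsf` v3, registered on stmt-BirchSwinnertonDyer-27047), verbatim.**  An
isogeny of odd degree between elliptic curves over `ℚ` preserves Greenberg's archimedean type bit «odd»
(`TwoTorsionOdd`: the abscissa is the least real root of the 2-division cubic) of the unique rational points
of order `2`: «odd» ⟺ «has an anti-real half `R ∈ E(ℂ)` (`conj R = −R`, `2R = T`)», and `φ_ℂ` commutes with
complex conjugation; the image of `T` is `T′` by uniqueness; converse by the dual isogeny.
[cite: GreenbergLNM1716, §5 p. 168 and Remark p. 174] [cite: SilvermanAEC2009, III.6.1] -/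
theorem stub_oddIsoArch :
    ∀ (W W' : WeierstrassCurve ℚ) [W.IsElliptic] [W'.IsElliptic] (φ : WeierstrassCurve.Isogeny W W'),
      Odd φ.degree → ∀ x x' : ℚ, HasUniqueRationalTwoTorsionX W x → HasUniqueRationalTwoTorsionX W' x' →
        (TwoTorsionOdd W x ↔ TwoTorsionOdd W' x') := by
  intro W W' _ _ φ hdeg x x' hx hx'
  obtain ⟨⟨y, hxy, h2⟩, huniq⟩ := hx
  have hT : W.toAffine.Nonsingular x y := (WeierstrassCurve.Affine.equation_iff_nonsingular).mp hxy
  obtain ⟨x₁, y₁, hT₁, hφ, hx₁⟩ := exists_hasUniqueRationalTwoTorsionX_of_isogeny_of_odd φ hdeg hT h2 huniq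
  have hx₁x' : x₁ = x' := hx'.2 x₁ hx₁.1
  subst hx₁x'
  exact twoTorsionOdd_iff_of_isogeny_apply_eq φ hdeg hT hT₁ h2 hφ

end Summit.BirchSwinnertonDyer.BirchSwinnertonDyer.Theorems.DepletionAtTwo.NsfStubs

end
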